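import Summits.AtomisticToContinuum.Crystallization.Theorems.HullExactificationCascadeHullGoodEverywhere

/-!
# Crux `DisclinationRation.HullGlue` (stmt-AtomisticToContinuum-15802), line `birth` —
# stub 3 `stub_siteGoodOfLimit`: fixed-tolerance goodness is closed under local convergence

The load-bearing step of the second hull exactification.  Let `X k ⊆ ℝ³` be `δ`-separated
(`δ > 0`) and `R₁`-dense point sets converging locally to the `δ`-separated `S₂`
(`BallMatch ε R 0 (X k) S₂` eventually in `k`, every `R`, every `ε > 0`), and suppose every point
of `X k` of norm `≤ k` is `SiteGood` in `X k` (first shell `1/20`-matched to the fcc or the hcp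
kissing pattern, site-dependent scale `d`, strict cutoff `13/10·d`, closed tolerance `≤ 1/20`).
Then EVERY point of `S₂` is `SiteGood` in `S₂`.

Proof (`stub_siteGoodOfLimit`): follow `y ∈ S₂` back along nearest approximants
`p k := nearPt (X k) y → y` (`hge_exists_approx`); for large `k`, `‖p k‖ < ‖y‖ + 1 ≤ k`, so `p k`
is good in `X k`; `R₁`-denseness probed at the point `p k + w`, `‖w‖ = R₁ + 1`, gives ANOTHER point
of `X k` within `2 R₁ + 1` of `p k`, hence the scale bound needed to restate `SiteGood` as
`PatternGood` for one of the two patterns (`SiteGood.patternGood`); one pattern occurs frequently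
(`hge_frequently_or`), and along that subsequence the landed closedness engine
`hge_patternGood_of_limit` (compactness of `O(3)`, finitely many labellings, unit pattern vectors
⇒ annular gap `[19d/20, 21d/20]` against the cutoff `13d/10`, closed `≤ 1/20`) gives `PatternGood`
at `y` in `S₂`, hence `SiteGood` (`PatternGood.siteGood`).  All `[folklore]` (Radin 1991 §2–3;
Baake–Grimm 2013, Remark 5.6); the engines are the landed files
`HullExactificationCascadeHullGoodEverywhere{Core,Snap,GoodAPI}.lean`.
-/

noncomputable section

namespace Summit.AtomisticToContinuum.Crystallization.Theorems.DisclinationRationHullGlue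

open Filter Topology Metric
open Literature.MathematicalPhysics.StatisticalMechanics Literature.Geometry.DiscreteGeometry
open Summit.AtomisticToContinuum.Crystallization.Theorems

/-- **Stub 3 of line `birth` (crux `HullGlue`, stmt-AtomisticToContinuum-15802): fixed-tolerance
goodness is closed under local convergence.**  If `δ`-separated (`δ > 0`), `R₁`-dense sets
`X k ⊆ ℝ³` converge locally to the `δ`-separated `S₂` and every point of `X k` of norm `≤ k` is
`SiteGood` in `X k`, then every point of `S₂` is `SiteGood` in `S₂` (same closed tolerance `1/20`,
same strict cutoff `13/10·d`, site-dependent scale `d`). [folklore] -/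
theorem stub_siteGoodOfLimit : ∀ (X : ℕ → Set (EuclideanSpace ℝ (Fin 3))) (S₂ : Set (EuclideanSpace ℝ (Fin 3))) (δ R₁ : ℝ), 0 < δ → (∀ k : ℕ, ∀ y ∈ X k, ∀ z ∈ X k, y ≠ z → δ ≤ dist y z) → (∀ y ∈ S₂, ∀ z ∈ S₂, y ≠ z → δ ≤ dist y z) → (∀ k : ℕ, ∀ p : EuclideanSpace ℝ (Fin 3), ∃ y ∈ X k, dist y p ≤ R₁) → (∀ R ε : ℝ, 0 < ε → ∀ᶠ k : ℕ in Filter.atTop, Literature.MathematicalPhysics.StatisticalMechanics.BallMatch ε R 0 (X k) S₂) → (∀ k : ℕ, ∀ z ∈ X k, ‖z‖ ≤ (k : ℝ) → Summit.AtomisticToContinuum.Crystallization.Theorems.SiteGood (X k) z) → ∀ y ∈ S₂, Summit.AtomisticToContinuum.Crystallization.Theorems.SiteGood S₂ y := by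
  intro X S₂ δ R₁ hδ hXsep hSsep hdense hlim hgood y hyS
  classical
  -- the density radius is nonnegative
  have hR₁ : 0 ≤ R₁ := by
    obtain ⟨z, -, hz⟩ := hdense 0 0
    exact dist_nonneg.trans hz
  obtain ⟨⟨hf1, hfne⟩, ⟨hh1, hhne⟩⟩ := hge_patterns_unit_nonempty
  -- a vector of norm `R₁ + 1` (a rescaled pattern vector), to probe denseness away from a point
  obtain ⟨w, hw⟩ : ∃ w : EuclideanSpace ℝ (Fin 3), ‖w‖ = R₁ + 1 := by
    obtain ⟨v, hv⟩ := hfne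
    refine ⟨(R₁ + 1) • v, ?_⟩
    rw [norm_smul, Real.norm_eq_abs, abs_of_nonneg (by linarith), hf1 v hv, mul_one]
  -- every point of `X k` has ANOTHER point of `X k` within `2 R₁ + 1`
  have hnb : ∀ k, ∀ p ∈ X k, ∃ z ∈ X k, z ≠ p ∧ dist z p ≤ 2 * R₁ + 1 := by
    intro k p hp
    obtain ⟨z, hz, hzq⟩ := hdense k (p + w)
    have hpw : dist (p + w) p = R₁ + 1 := by
      rw [dist_eq_norm, add_sub_cancel_left, hw]
    refine ⟨z, hz, ?_, ?_⟩
    · rintro rfl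
      rw [dist_comm] at hpw
      linarith
    · calc dist z p ≤ dist z (p + w) + dist (p + w) p := dist_triangle _ _ _
        _ ≤ R₁ + (R₁ + 1) := by rw [hpw]; linarith
        _ = 2 * R₁ + 1 := by ring
  -- approximants of `y`
  obtain ⟨hpY, hpy⟩ := hge_exists_approx hδ hXsep hlim hyS
  set p : ℕ → EuclideanSpace ℝ (Fin 3) := fun k => nearPt (X k) y with hp
  have hnorm : ∀ᶠ k in atTop, ‖p k‖ < ‖y‖ + 1 := by
    filter_upwards [Metric.tendsto_nhds.1 hpy 1 one_pos] with k hk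
    have := norm_le_norm_add_norm_sub' (p k) y
    rw [← dist_eq_norm] at this
    linarith
  have hk1 : ∀ᶠ k : ℕ in atTop, ‖y‖ + 1 ≤ (k : ℝ) :=
    tendsto_natCast_atTop_atTop.eventually_ge_atTop _
  -- eventually `p k` is a good point of `X k`, `PatternGood` for one pattern with scale `≤ 2R₁+1`
  have hev : ∀ᶠ k in atTop, p k ∈ X k ∧
      (PatternGood fccKissingPattern (2 * R₁ + 1) (X k) (p k) ∨
        PatternGood hcpKissingPattern (2 * R₁ + 1) (X k) (p k)) := by
    filter_upwards [hpY, hnorm, hk1] with k hk hkn hk1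
    exact ⟨hk, (hgood k (p k) hk (by linarith)).patternGood (hnb k (p k) hk)⟩
  -- one pattern frequently; extract and pass to the limit
  refine PatternGood.siteGood (R₀ := 2 * R₁ + 1) ?_
  rcases hge_frequently_or hev with hfr | hfr
  · obtain ⟨ψ, hψ, hψP⟩ := extraction_of_frequently_atTop hfr
    exact Or.inl (hge_patternGood_of_limit hf1 hfne hδ (fun k => hXsep (ψ k)) hSsep
      (fun R ε hε => hψ.tendsto_atTop.eventually (hlim R ε hε)) (fun k => (hψP k).1)
      (hpy.comp hψ.tendsto_atTop) (fun k => (hψP k).2))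
  · obtain ⟨ψ, hψ, hψP⟩ := extraction_of_frequently_atTop hfr
    exact Or.inr (hge_patternGood_of_limit hh1 hhne hδ (fun k => hXsep (ψ k)) hSsep
      (fun R ε hε => hψ.tendsto_atTop.eventually (hlim R ε hε)) (fun k => (hψP k).1)
      (hpy.comp hψ.tendsto_atTop) (fun k => (hψP k).2))

end Summit.AtomisticToContinuum.Crystallization.Theorems.DisclinationRationHullGlue

end
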